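import Summits.HodgeConjecture.HodgeConjecture.Cruxes.BlochSeedDiscOne.BnCCertCover4

/-!
# BnCCertCover7 — module 7 of the «v1 + L1(.5) + ℤ + S + O» checker (dual g12, 2026-08-30): image 3's representative N-pass, chunks 8–15 (columns 680 … 1359) of 16 × 85

Module 4 (`BnCCertCover4.lean` 832c00c23d18) proves the (U2) end theorem modulo `PassOK lf3 Side.N ∕ Side.P`; module 5 discharges the P-pass.
The N-pass has ≤ 1 356 representative columns (`img3_repsN_le`) = 16 chunks of 85: chunks 0–7 in module 6, chunks 8–15 in module 7 (both import
only module 4, so they build independently); module 8 chains them (`all_drop_of_chunk`, definitional unfolding of the per-module copies `QN6 ∕ QN7`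
of the same predicate) into `pass3N` and states the hypothesis-free half-region theorem.  Nothing here is proved toward `FloorFree 6 199 8` ∕ 18881 ∕ H2 ∕ HC: chunk lemmas of one image's ordered pass are evidence that a MODEL-grade certificate replays, not a floor statement.
-/

set_option autoImplicit false

namespace Summit.HodgeConjecture.HodgeConjecture.Cruxes.BlochSeedDiscOne.BnCCertCover

open Summit.HodgeConjecture.HodgeConjecture.Cruxes.BlochSeedDiscOne.DepthBoundA4
open Summit.HodgeConjecture.HodgeConjecture.Cruxes.BlochSeedDiscOne.RingFiveEmpty
open Summit.HodgeConjecture.HodgeConjecture.Cruxes.BlochSeedDiscOne.BnCCert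

namespace Replay4273

/-- image 3's pointwise predicate on side `N` and its representative column list (§41 `ordColsR`) -/
def QN7 : STuple → Bool :=
  ptOKO (ents C5.vars lf3.n.m.core.base) γ0 lf3.n.m.core.base.L lf3.n.m.core.base.ρ lf3.n.m.core.bans (lf3.n.m.presEff C5.B) lf3.n.m.core.kbans
    lf3.n.m.core.kpres lf3.n.m.core.ephi lf3.orows (lf3.X C5.B) (obanHit lf3.obans) Side.N
def colsN7 : List STuple := ordColsR C5.h (allBounds C5.vars lf3.n.m.core.base) Side.N

theorem N7_c8 : (((colsN7).drop (0 + 85 + 85 + 85 + 85 + 85 + 85 + 85 + 85)).take 85).all QN7 = true := by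
  decide +kernel
theorem N7_c9 : (((colsN7).drop (0 + 85 + 85 + 85 + 85 + 85 + 85 + 85 + 85 + 85)).take 85).all QN7 = true := by
  decide +kernel
theorem N7_c10 : (((colsN7).drop (0 + 85 + 85 + 85 + 85 + 85 + 85 + 85 + 85 + 85 + 85)).take 85).all QN7 = true := by
  decide +kernel
theorem N7_c11 : (((colsN7).drop (0 + 85 + 85 + 85 + 85 + 85 + 85 + 85 + 85 + 85 + 85 + 85)).take 85).all QN7 = true := by
  decide +kernel
theorem N7_c12 : (((colsN7).drop (0 + 85 + 85 + 85 + 85 + 85 + 85 + 85 + 85 + 85 + 85 + 85 + 85)).take 85).all QN7 = true := by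
  decide +kernel
theorem N7_c13 : (((colsN7).drop (0 + 85 + 85 + 85 + 85 + 85 + 85 + 85 + 85 + 85 + 85 + 85 + 85 + 85)).take 85).all QN7 = true := by
  decide +kernel
theorem N7_c14 : (((colsN7).drop (0 + 85 + 85 + 85 + 85 + 85 + 85 + 85 + 85 + 85 + 85 + 85 + 85 + 85 + 85)).take 85).all QN7 = true := by
  decide +kernel
theorem N7_c15 : (((colsN7).drop (0 + 85 + 85 + 85 + 85 + 85 + 85 + 85 + 85 + 85 + 85 + 85 + 85 + 85 + 85 + 85)).take 85).all QN7 = true := by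
  decide +kernel

end Replay4273

end Summit.HodgeConjecture.HodgeConjecture.Cruxes.BlochSeedDiscOne.BnCCertCover
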